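import Literature.AlgebraicGeometry.Resolution.CentreBlowupMohStability
import Literature.AlgebraicGeometry.Resolution.CentreBlowupOrdAlongBasics
import Literature.AlgebraicGeometry.Resolution.WeightedBlowupNoIncrease
import Literature.AlgebraicGeometry.Resolution.OrdZeroBasics
import Mathlib.Algebra.MvPolynomial.Division
import HarnessLib

/-!
# [OURS · res-dim4-pi PR-3] `near_dim = n − 1` at small order gaps: `ord_{C_S} F ≥ 2q` makes the WHOLE
  exceptional hyperplane of every chart equimultiple, and the new exceptional divisor an equimultiple centre

Cell `res-dim4-pi` (D-0157 DOOR 2; purely inseparable hypersurfaces `z^q + F(y₁..y_n)`, class of record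
`(n, e) = (4, 1)`), wave 2, brick **PR-3** of `pub/res-dim4/boards/WAVE2.md` (seat `res-dim4-p-3`). Model =
the tree's coordinate-centre walk of `PointBlowupShadeCentres.lean` (`CentreBlowup.ordAlong S F = ord_{C_S} F`,
the `y_j`-chart law `chartExponent/chartTransform` "`x_i ↦ x₁x_i (i ∈ S)`, divide by `x₁^q`"
[HauserPerlega2019PRIMS, §2], `pointTransform = translate b ∘ chartTransform`, the cleaning
`Hauser2010.deletePthPowers`, `step`, and `IsEquimultiplePoint` = "the transform is again `q`-fold there"
[Hauser2010, §F]) and the point model `PointBlowup.*` of `PointBlowupShade.lean`; cited, never restated.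

## What is proved (any commutative ring `K`, finite `σ`, any `q`, `S`, chart `j`, and EVERY point `b` of the
## chart's exceptional hyperplane `{y_j = 0}`: `b_j = 0`, all other `b_i` free — translations along the centre too)

With `n + q ≤ ord_{C_S} F` (support form: `Σ_{i∈S} dᵢ ≥ n + q` on every monomial `y^d` of `F`):
* §1–§3 `X_pow_dvd_chartTransform`, `X_pow_dvd_pointTransform`, `le_ordAlong_singleton_pointTransform`,
  `le_ordZero_pointTransform`: `y_j^n` divides the chart transform (`d'_j = Σ_{i∈S} dᵢ − q`) and the point
  transform at every such `b` (a translation with `b_j = 0` keeps `y_j`-exponents) — the desk's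
  "`F ∈ 𝔪^{2q} ⇒ F′ ∈ (x_j)^q·…`".
* §4 **`isEquimultiplePoint_of_two_mul_le_ordAlong` (the brick)**: `2q ≤ ord_{C_S} F ⇒
  CentreBlowup.IsEquimultiplePoint q S j b s` for EVERY chart `j` and EVERY `b` with `b_j = 0`: the near locus
  above the centre is the whole exceptional divisor — `near_dim = n − 1` in the engines' per-state field
  (WORD #10 / #14 (c) of `pub/res-dim4/boards/ROUTES.md`, the «near(exc)» artefact `r_new = ord F − q ≥ q`).
  Class instance, for every `q` and coordinate centres of any dimension, of the barrier
  `Literature.Barriers.ResolutionOfSingularities.StratumFirstInvIncrease` (`q = 2`: `x² + G`, `G ∈ 𝔪^{a+2}`,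
  `a ≥ 2`, `f′ ∈ (x, y_j)²` on the whole exceptional section).
* §5 `le_ordAlong_singleton_step_of_two_mul_le`: cleaning deletes monomials and creates none, so after the
  step `q ≤ ord_{(y_j)} F'`: the new exceptional divisor `C_{{j}}` is ITSELF a coordinate centre in the
  `q`-fold locus (HP condition (1) for `Γ = {j}`, `|Γ| = 1`) — under a smallest-cardinality-first rule such as
  MODE 1h the next edge is a DIV edge, "removed by the next DIV step" (WORD #14 (c)). `X_pow_step_r_dvd_step_F`:
  the bookkeeping `r'_j = ord_{C_S} F − q` really divides `F'` (no hypothesis).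
* §6 `X_pow_mul_chartTransform_singleton`: the DIV step IS division by `y_j^q` (`q ≤ ord_{(y_j)} F`).
* §7 point model: **`point_isEquimultiplePoint_of_two_mul_le_ordZero`** (`2q ≤ ord₀ F ⇒
  PointBlowup.IsEquimultiplePoint q j b s`, the desk's wording), and `isEquimultiplePoint_univ_of_two_mul_le_ordZero`
  (`CState`, `S = univ`, field, via the tree's `ordAlong_univ`).
* §8 specimen `z14_isEquimultiplePoint_univ`: zoo row Z14 (`z² + xywt`, `p = 2`, point blow-up) — every point
  of every chart's exceptional hyperplane is near (eng-A S-0: "all 15 𝔽₂-points near"), any bookkeeping.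

Not here: where the near points lie when `ord F < 2q` (ridge / directrix of the tangent cone) — the tree's
`PointBlowupNearRidge.inRidge_of_isEquimultiplePoint` ([CJS 2020] Thm. 3.14 in the model).
[OURS · counted 0 · elementary bookkeeping over the tree's model; AI kernel work, weaker than expert review.]
Census/instrument value (which configurations are LOCUS by necessity: every monomial of the cleaned `F` has
`S`-degree `≥ 2q`; at `p = 2`, `e = 1`: `ord F ≥ 4`). Nothing here is a statement about resolution of
singularities; resolution in dimension `≥ 4` / characteristic `p > 0` is NOT proved by anything in this file.
Host item (DR-157-C): `stmt-ResolutionOfSingularities-16155` (`MarkedTransfer.HypersurfaceOrderReduction`), helper.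
-/

noncomputable section

set_option linter.dupNamespace false -- mandated namespace of this single-conjunct summit

open MvPolynomial Finset
open scoped BigOperators

namespace Summit.ResolutionOfSingularities.ResolutionOfSingularities.Theorems.PIDim4.NearDim

open Literature.AlgebraicGeometry.Resolution
open Literature.AlgebraicGeometry.Resolution.CentreBlowup
open Literature.AlgebraicGeometry.Resolution.Hauser2010

variable {σ : Type*} {K : Type*} [CommRing K] [Fintype σ] [DecidableEq σ]

/-! ## §1 Divisibility by a power of one variable, read on the support -/

omit [Fintype σ] [DecidableEq σ] in
/-- If every monomial `y^E` of `P` has `E_j ≥ n`, then `y_j^n ∣ P`. OURS (bookkeeping; Mathlib's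
`monomial_one_dvd_iff_modMonomial_eq_zero`). -/
theorem X_pow_dvd_of_forall_le_apply {P : MvPolynomial σ K} {j : σ} {n : ℕ}
    (h : ∀ E ∈ P.support, n ≤ E j) : (X j : MvPolynomial σ K) ^ n ∣ P := by
  rw [X_pow_eq_monomial, monomial_one_dvd_iff_modMonomial_eq_zero]
  ext E
  rw [coeff_zero]
  by_cases hle : Finsupp.single j n ≤ E
  · exact coeff_modMonomial_of_le _ hle
  · rw [coeff_modMonomial_of_not_le _ hle]
    by_contra hne
    exact hle (Finsupp.single_le_iff.mpr (h E (MvPolynomial.mem_support_iff.mpr hne)))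

omit [Fintype σ] [DecidableEq σ] in
/-- `m ≤ ord_{C_S} F` in support form (tree `le_ordAlong_iff`). [cite: HauserPerlega2019PRIMS, §2 (ord_P)] -/
theorem forall_le_degIn_of_le_ordAlong {S : Finset σ} {F : MvPolynomial σ K} {m : ℕ}
    (h : (m : ℕ∞) ≤ ordAlong S F) : ∀ d ∈ F.support, m ≤ degIn S d := fun d hd => by
  exact_mod_cast (le_ordAlong_iff.mp h) d hd

/-! ## §2 The chart transform lies in `(y_j)^{ord_S F − q}` -/

omit [Fintype σ] in
/-- **`y_j`-exponents of the chart transform.** If every monomial `y^d` of `F` has `Σ_{i∈S} dᵢ ≥ n + q`,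
then every monomial of `chartTransform q S j F` has `y_j`-exponent `≥ n` (the chart law gives
`d'_j = Σ_{i∈S} dᵢ − q`, tree `CentreBlowup.chartExponent_apply_self`). OURS (elementary).
[cite: HauserPerlega2019PRIMS, §2 (the blowup in the x₁-chart)] -/
theorem le_apply_of_mem_support_chartTransform {q n : ℕ} {S : Finset σ} {j : σ}
    {F : MvPolynomial σ K} (hF : ∀ d ∈ F.support, n + q ≤ degIn S d) {E : σ →₀ ℕ}
    (hE : E ∈ (chartTransform q S j F).support) : n ≤ E j := by
  rw [MvPolynomial.mem_support_iff] at hE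
  unfold chartTransform at hE
  rw [coeff_sum] at hE
  obtain ⟨d, hd, hne⟩ := Finset.exists_ne_zero_of_sum_ne_zero hE
  rw [coeff_monomial] at hne
  by_cases h : chartExponent q S j d = E
  · rw [← h, chartExponent_apply_self]
    have := hF d hd
    omega
  · rw [if_neg h] at hne
    exact (hne rfl).elim

omit [Fintype σ] in
/-- **The chart transform is divisible by `y_j^{ord_S F − q}`**: `n + q ≤ Σ_{i∈S} dᵢ` on the support of `F`
gives `y_j^n ∣ chartTransform q S j F` (the desk's "`F ∈ 𝔪^{2q} ⇒ F′ ∈ (x_j)^q·…`" is `n = q`).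
OURS (elementary). [cite: HauserPerlega2019PRIMS, §2 (the blowup in the x₁-chart)] -/
theorem X_pow_dvd_chartTransform {q n : ℕ} {S : Finset σ} {j : σ} {F : MvPolynomial σ K}
    (hF : ∀ d ∈ F.support, n + q ≤ degIn S d) :
    (X j : MvPolynomial σ K) ^ n ∣ chartTransform q S j F :=
  X_pow_dvd_of_forall_le_apply fun _ hE => le_apply_of_mem_support_chartTransform hF hE

/-! ## §3 … at every point `b` of the exceptional hyperplane `{y_j = 0}` -/

/-- **`y_j`-exponents survive the translation to any point of `{y_j = 0}`.** For `b_j = 0` and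
`n + q ≤ Σ_{i∈S} dᵢ` on the support of `F`, every monomial of `pointTransform q S j b s` has `y_j`-exponent
`≥ n` (`(y + b)^{d'}` keeps the exponent of the untranslated `y_j`; no hypothesis on the other `b_i`:
translations along the centre allowed). OURS. [cite: Hauser2010, §F (chart expressions of a point blowup)] -/
theorem le_apply_of_mem_support_pointTransform {q n : ℕ} {S : Finset σ} {j : σ} {b : σ → K}
    (hbj : b j = 0) {s : CState σ K} (hF : ∀ d ∈ s.F.support, n + q ≤ degIn S d) {E : σ →₀ ℕ}
    (hE : E ∈ (pointTransform q S j b s).support) : n ≤ E j := by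
  have hsum : pointTransform q S j b s =
      ∑ d ∈ s.F.support, PointBlowup.translate b (monomial (chartExponent q S j d) (coeff d s.F)) := by
    unfold pointTransform chartTransform PointBlowup.translate
    rw [map_sum]
  rw [MvPolynomial.mem_support_iff, hsum, coeff_sum] at hE
  obtain ⟨d, hd, hne⟩ := Finset.exists_ne_zero_of_sum_ne_zero hE
  have h1 : chartExponent q S j d j ≤ E j := by
    by_contra hlt
    exact hne (WeightedBlowup.coeff_translate_monomial_eq_zero_of_apply_eq_zero b _ _ _ hbj
      (not_le.mp hlt))
  rw [chartExponent_apply_self] at h1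
  have := hF d hd
  omega

/-- **`y_j^{ord_S F − q}` divides the point transform at every point of the exceptional hyperplane.**
OURS (elementary). [cite: Hauser2010, §F (chart expressions of a point blowup)] -/
theorem X_pow_dvd_pointTransform {q n : ℕ} {S : Finset σ} {j : σ} {b : σ → K} (hbj : b j = 0)
    {s : CState σ K} (hF : ∀ d ∈ s.F.support, n + q ≤ degIn S d) :
    (X j : MvPolynomial σ K) ^ n ∣ pointTransform q S j b s :=
  X_pow_dvd_of_forall_le_apply fun _ hE => le_apply_of_mem_support_pointTransform hbj hF hE

/-- `n + q ≤ ord_{C_S} F ⇒ n ≤ ord_{(y_j)}(pointTransform)`. OURS. [cite: HauserPerlega2019PRIMS, §2 (ord_P)] -/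
theorem le_ordAlong_singleton_pointTransform {q n : ℕ} {S : Finset σ} {j : σ} {b : σ → K}
    (hbj : b j = 0) {s : CState σ K} (hF : ((n + q : ℕ) : ℕ∞) ≤ ordAlong S s.F) :
    (n : ℕ∞) ≤ ordAlong {j} (pointTransform q S j b s) :=
  le_ordAlong_of_forall fun E hE => by
    rw [degIn_singleton]
    exact le_apply_of_mem_support_pointTransform hbj (forall_le_degIn_of_le_ordAlong hF) hE

/-- So the point transform has order `≥ ord_S F − q` at EVERY point of `{y_j = 0}` (before cleaning;
the constant term vanishes too). OURS (elementary). [cite: Hauser2010, §C (order of X at a point)] -/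
theorem le_ordZero_pointTransform {q n : ℕ} {S : Finset σ} {j : σ} {b : σ → K} (hbj : b j = 0)
    {s : CState σ K} (hF : ((n + q : ℕ) : ℕ∞) ≤ ordAlong S s.F) :
    (n : ℕ∞) ≤ ordZero (pointTransform q S j b s) := by
  rw [natCast_le_ordZero_iff_forall_coeff]
  intro d hd
  by_contra hne
  have h := le_apply_of_mem_support_pointTransform hbj (forall_le_degIn_of_le_ordAlong hF)
    (MvPolynomial.mem_support_iff.mpr hne)
  have := Finsupp.le_degree j d
  omega

/-! ## §4 The brick: the whole exceptional hyperplane is equimultiple (`near_dim = n − 1`) -/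

/-- **`near_dim = n − 1` at small order gaps (PR-3).** If `ord_{C_S} F ≥ 2q` (every monomial `y^d` of `F`
has `Σ_{i∈S} dᵢ ≥ 2q`) then for EVERY chart `y_j` and EVERY point `b` of its exceptional hyperplane
`{y_j = 0}` (`b_j = 0`; fibre coordinates `b_i`, `i ∈ S ∖ {j}`, and positions along the centre `b_i`,
`i ∉ S`, arbitrary) the point is equimultiple: the near locus above `C_S` is the whole exceptional divisor
(dimension `n − 1`), the engines' `near_dim = n − 1` / LOCUS flag is forced. Class instance for every `q` of
the barrier `StratumFirstInvIncrease` (`q = 2`). OURS (elementary; census value, nothing about resolution).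
[cite: Hauser2010, §F (equiconstant points)] -/
theorem isEquimultiplePoint_of_two_mul_le_ordAlong {q : ℕ} {S : Finset σ} (j : σ) {b : σ → K}
    (hbj : b j = 0) {s : CState σ K} (hF : ((2 * q : ℕ) : ℕ∞) ≤ ordAlong S s.F) :
    IsEquimultiplePoint q S j b s := by
  intro d _ hdq
  by_contra hne
  have hF' : ∀ e ∈ s.F.support, q + q ≤ degIn S e := fun e he => by
    have := forall_le_degIn_of_le_ordAlong hF e he
    omega
  have h := le_apply_of_mem_support_pointTransform hbj hF' (MvPolynomial.mem_support_iff.mpr hne)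
  have := Finsupp.le_degree j d
  omega

/-- Support form of the brick (the shape the engines test on a configuration: every monomial of the
cleaned `F` has `S`-degree `≥ 2q`). OURS (elementary). [cite: Hauser2010, §F (equiconstant points)] -/
theorem isEquimultiplePoint_of_forall_two_mul_le_degIn {q : ℕ} {S : Finset σ} (j : σ) {b : σ → K}
    (hbj : b j = 0) {s : CState σ K} (hF : ∀ d ∈ s.F.support, 2 * q ≤ degIn S d) :
    IsEquimultiplePoint q S j b s :=
  isEquimultiplePoint_of_two_mul_le_ordAlong j hbj (le_ordAlong_of_forall hF)

/-! ## §5 After the cleaning: the new exceptional divisor is an equimultiple coordinate centre -/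

omit [Fintype σ] in
/-- Cleaning deletes monomials and creates none: the support of the new residual polynomial is contained
in that of the point transform (tree: `Hauser2010.coeff_deletePthPowers`).
[cite: Hauser2010, §G (cleaning of p-th power monomials)] -/
theorem mem_support_pointTransform_of_mem_support_step [DecidableEq K] {q : ℕ} {S : Finset σ} {j : σ}
    {b : σ → K} {s : CState σ K} {E : σ →₀ ℕ} (hE : E ∈ (step q S j b s).F.support) :
    E ∈ (pointTransform q S j b s).support := by
  have h := MvPolynomial.mem_support_iff.mp hE
  change coeff E (deletePthPowers q (pointTransform q S j b s)) ≠ 0 at h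
  rw [coeff_deletePthPowers] at h
  split_ifs at h with hP
  · exact (h rfl).elim
  · exact MvPolynomial.mem_support_iff.mpr h

/-- **`y_j`-exponents after the step.** At any `b` with `b_j = 0`: if `n + q ≤ Σ_{i∈S} dᵢ` on the support
of `F`, every monomial of `(step q S j b s).F` has `y_j`-exponent `≥ n`. OURS (elementary).
[cite: Hauser2010, §§F–G (blowup followed by cleaning)] -/
theorem le_apply_of_mem_support_step [DecidableEq K] {q n : ℕ} {S : Finset σ} {j : σ} {b : σ → K}
    (hbj : b j = 0) {s : CState σ K} (hF : ∀ d ∈ s.F.support, n + q ≤ degIn S d) {E : σ →₀ ℕ}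
    (hE : E ∈ (step q S j b s).F.support) : n ≤ E j :=
  le_apply_of_mem_support_pointTransform hbj hF (mem_support_pointTransform_of_mem_support_step hE)

/-- **`y_j^{ord_S F − q}` divides the new residual polynomial** at every point of `{y_j = 0}`.
OURS (elementary). [cite: Hauser2010, §§F–G (blowup followed by cleaning)] -/
theorem X_pow_dvd_step_F [DecidableEq K] {q n : ℕ} {S : Finset σ} {j : σ} {b : σ → K}
    (hbj : b j = 0) {s : CState σ K} (hF : ∀ d ∈ s.F.support, n + q ≤ degIn S d) :
    (X j : MvPolynomial σ K) ^ n ∣ (step q S j b s).F :=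
  X_pow_dvd_of_forall_le_apply fun _ hE => le_apply_of_mem_support_step hbj hF hE

/-- `n + q ≤ ord_{C_S} F ⇒ n ≤ ord_{(y_j)} F'` for the new residual polynomial `F'` at every point of
`{y_j = 0}`. OURS (elementary). [cite: HauserPerlega2019PRIMS, §2 (ord_P)] -/
theorem le_ordAlong_singleton_step [DecidableEq K] {q n : ℕ} {S : Finset σ} {j : σ} {b : σ → K}
    (hbj : b j = 0) {s : CState σ K} (hF : ((n + q : ℕ) : ℕ∞) ≤ ordAlong S s.F) :
    (n : ℕ∞) ≤ ordAlong {j} (step q S j b s).F :=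
  le_ordAlong_of_forall fun E hE => by
    rw [degIn_singleton]
    exact le_apply_of_mem_support_step hbj (forall_le_degIn_of_le_ordAlong hF) hE

/-- **The new exceptional divisor is itself an equimultiple coordinate centre.** If `2q ≤ ord_{C_S} F`
then after the step at ANY point `b` of `{y_j = 0}`: `q ≤ ord_{(y_j)} F'`, i.e. `F' ∈ (y_j)^q` — the
centre `C_{{j}} = {z = y_j = 0}` (the chart's exceptional divisor) lies in the `q`-fold locus of `z^q + F'`
(HP condition (1) for `Γ = {j}`; `|Γ| = 1`, so a smallest-cardinality-first rule such as MODE 1h blows up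
a divisor next: edge class DIV, the «near(exc)» artefact of WORD #14 (c)). OURS (elementary; census
value). [cite: HauserPerlega2019PRIMS, §2 (permissible blowups, `ord_P`)] -/
theorem le_ordAlong_singleton_step_of_two_mul_le [DecidableEq K] {q : ℕ} {S : Finset σ} {j : σ}
    {b : σ → K} (hbj : b j = 0) {s : CState σ K} (hF : ((2 * q : ℕ) : ℕ∞) ≤ ordAlong S s.F) :
    (q : ℕ∞) ≤ ordAlong {j} (step q S j b s).F :=
  le_ordAlong_singleton_step hbj (n := q) (by rwa [← two_mul])

omit [Fintype σ] in
/-- The model's bookkeeping at the chart variable: `r'_j = ord_{C_S} F − q` (tree `CentreBlowup.newMult`,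
by definition). [cite: HauserPerlega2019PRIMS, §2 (transform D' of D)] -/
theorem step_r_self [DecidableEq K] (q : ℕ) (S : Finset σ) (j : σ) (b : σ → K) (s : CState σ K) :
    (step q S j b s).r j = (ordAlong S s.F).toNat - q := by
  show newMult q S j b s j = _
  unfold newMult
  rw [Finsupp.update_apply, if_pos rfl]

/-- **The recorded multiplicity of the new component really divides**: `y_j^{r'_j} ∣ F'` at every point of
`{y_j = 0}`, no hypothesis (exponent `0` if `F = 0` or `ord_{C_S} F < q`); the tree's
`CentreBlowup.newMult_le_of_mem_support_step` is the all-components form under Moh-permissibility.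
OURS (elementary). [cite: HauserPerlega2019PRIMS, §2 (transform D' of D)] -/
theorem X_pow_step_r_dvd_step_F [DecidableEq K] (q : ℕ) (S : Finset σ) (j : σ) {b : σ → K}
    (hbj : b j = 0) (s : CState σ K) :
    (X j : MvPolynomial σ K) ^ ((step q S j b s).r j) ∣ (step q S j b s).F := by
  rw [step_r_self]
  by_cases hF0 : s.F = 0
  · rw [hF0, ordAlong_zero, ENat.toNat_top, Nat.zero_sub, pow_zero]
    exact one_dvd _
  obtain ⟨d₀, -, hm⟩ := exists_mem_support_ordAlong_eq S hF0
  rw [hm, ENat.toNat_coe]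
  by_cases hq : q ≤ degIn S d₀
  · refine X_pow_dvd_step_F hbj fun d hd => ?_
    have h := ordAlong_le_of_mem_support (S := S) hd
    rw [hm] at h
    have : degIn S d₀ ≤ degIn S d := by exact_mod_cast h
    omega
  · rw [Nat.sub_eq_zero_of_le (by omega), pow_zero]
    exact one_dvd _

/-! ## §6 The DIV step is division by `y_j^q` -/

omit [Fintype σ] in
/-- **Blowing up the divisor `{z = y_j = 0}` divides the residual polynomial by `y_j^q`** (centre
`Γ = {j}`, its only chart `y_j`): if `q ≤ ord_{(y_j)} F` then `y_j^q · chartTransform q {j} j F = F`.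
(Blowing up a Cartier divisor is an isomorphism; in `z^q + F` with `y_j^q ∣ F` the substitution
`z ↦ z·y_j` factors `y_j^q` off — only the bookkeeping `(F, r)` changes.) OURS (elementary).
[cite: HauserPerlega2019PRIMS, §2 (the blowup in the x₁-chart)] -/
theorem X_pow_mul_chartTransform_singleton {q : ℕ} {j : σ} {F : MvPolynomial σ K}
    (hF : (q : ℕ∞) ≤ ordAlong {j} F) :
    (X j : MvPolynomial σ K) ^ q * chartTransform q {j} j F = F := by
  have hq : ∀ d ∈ F.support, q ≤ d j := fun d hd => by
    have := forall_le_degIn_of_le_ordAlong hF d hd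
    rwa [degIn_singleton] at this
  have hexp : ∀ d ∈ F.support, Finsupp.single j q + chartExponent q {j} j d = d := by
    intro d hd
    ext i
    rw [Finsupp.add_apply, chartExponent_apply, degIn_singleton, Finsupp.single_apply]
    by_cases hij : i = j
    · subst hij
      rw [if_pos rfl, if_pos rfl]
      have := hq d hd
      omega
    · rw [if_neg hij, if_neg (Ne.symm hij), zero_add]
  unfold chartTransform
  rw [Finset.mul_sum]
  conv_rhs => rw [F.as_sum]
  refine Finset.sum_congr rfl fun d hd => ?_
  rw [X_pow_eq_monomial, monomial_mul, one_mul, hexp d hd]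

/-! ## §7 The point blow-up (`PointBlowupShade` model) -/

/-- **`y_j`-exponents at every point of the exceptional divisor of a POINT blow-up** (`b_j = 0`,
`n + q ≤ |d|` on the support of `F`): every monomial of `PointBlowup.pointTransform q j b s` has
`y_j`-exponent `≥ n` (`d'_j = |d| − q`). OURS. [cite: Hauser2010, §F (chart expressions of a point blowup)] -/
theorem point_le_apply_of_mem_support_pointTransform {q n : ℕ} {j : σ} {b : σ → K} (hbj : b j = 0)
    {s : PointBlowup.State σ K} (hF : ∀ d ∈ s.F.support, n + q ≤ d.degree) {E : σ →₀ ℕ}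
    (hE : E ∈ (PointBlowup.pointTransform q j b s).support) : n ≤ E j := by
  have hsum : PointBlowup.pointTransform q j b s = ∑ d ∈ s.F.support,
      PointBlowup.translate b (monomial (PointBlowup.chartExponent q j d) (coeff d s.F)) := by
    unfold PointBlowup.pointTransform PointBlowup.chartTransform PointBlowup.translate
    rw [map_sum]
  rw [MvPolynomial.mem_support_iff, hsum, coeff_sum] at hE
  obtain ⟨d, hd, hne⟩ := Finset.exists_ne_zero_of_sum_ne_zero hE
  have h1 : PointBlowup.chartExponent q j d j ≤ E j := by
    by_contra hlt
    exact hne (WeightedBlowup.coeff_translate_monomial_eq_zero_of_apply_eq_zero b _ _ _ hbj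
      (not_le.mp hlt))
  rw [PointBlowup.chartExponent_apply, if_pos rfl] at h1
  have := hF d hd
  omega

/-- `y_j^{ord₀ F − q}` divides the point transform of the point blow-up at every point of the exceptional
divisor in the chart `y_j`. OURS (elementary). [cite: Hauser2010, §F (chart expressions of a point blowup)] -/
theorem point_X_pow_dvd_pointTransform {q n : ℕ} {j : σ} {b : σ → K} (hbj : b j = 0)
    {s : PointBlowup.State σ K} (hF : ∀ d ∈ s.F.support, n + q ≤ d.degree) :
    (X j : MvPolynomial σ K) ^ n ∣ PointBlowup.pointTransform q j b s :=
  X_pow_dvd_of_forall_le_apply fun _ hE => point_le_apply_of_mem_support_pointTransform hbj hF hE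

/-- **`near_dim = n − 1` for the point blow-up** (the desk's wording of PR-3): `2q ≤ ord₀ F ⇒` EVERY
point `b` of the exceptional divisor in every chart `y_j` (`b_j = 0`) is equimultiple,
`PointBlowup.IsEquimultiplePoint q j b s`. OURS (census value). [cite: Hauser2010, §F (equiconstant points)] -/
theorem point_isEquimultiplePoint_of_two_mul_le_ordZero {q : ℕ} (j : σ) {b : σ → K} (hbj : b j = 0)
    {s : PointBlowup.State σ K} (hF : ((2 * q : ℕ) : ℕ∞) ≤ ordZero s.F) :
    PointBlowup.IsEquimultiplePoint q j b s := by
  intro d _ hdq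
  by_contra hne
  have hF' : ∀ e ∈ s.F.support, q + q ≤ e.degree := fun e he => by
    have h2 : 2 * q ≤ e.degree := by
      by_contra hlt
      exact (MvPolynomial.mem_support_iff.mp he)
        ((natCast_le_ordZero_iff_forall_coeff s.F (2 * q)).mp hF e (not_le.mp hlt))
    omega
  have h := point_le_apply_of_mem_support_pointTransform hbj hF' (MvPolynomial.mem_support_iff.mpr hne)
  have := Finsupp.le_degree j d
  omega

/-- The same for the `CState` of the coordinate-centre model with `S` = all variables (the point), over a
field, in the `ord₀` currency (tree: `CentreBlowup.ordAlong_univ`). OURS (elementary).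
[cite: Hauser2010, §F (equiconstant points)] -/
theorem isEquimultiplePoint_univ_of_two_mul_le_ordZero {L : Type*} [Field L] {q : ℕ} (j : σ)
    {b : σ → L} (hbj : b j = 0) {s : CState σ L} (hF : ((2 * q : ℕ) : ℕ∞) ≤ ordZero s.F) :
    IsEquimultiplePoint q Finset.univ j b s :=
  isEquimultiplePoint_of_two_mul_le_ordAlong j hbj (by rwa [ordAlong_univ])

/-! ## §8 Specimen: the zoo row Z14 (`z² + xywt`, `p = 2`) under the point blow-up -/

/-- **Zoo row Z14 of `pub/res-dim4/boards/DIM4-CENSUS.md` §B (`f = z² + xywt` on `𝔸⁵`, `(n, p, e) =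
(4, 2, 1)`), point blow-up (MODE 0):** `ord₀(xywt) = 4 = 2q`, so in EVERY chart EVERY point of the
exceptional hyperplane is equimultiple, whatever the bookkeeping `(r, exc)` — over `𝔽₂` these are the
"15 𝔽₂-points near" (`|ℙ³(𝔽₂)| = 15`) reported by eng-A's S-0 replay; here for every point over every
non-trivial commutative ring. OURS (kernel instance of `isEquimultiplePoint_of_two_mul_le_ordAlong`;
calibration value only). [cite: Hauser2010, §F (equiconstant points)] -/
theorem z14_isEquimultiplePoint_univ {L : Type*} [CommRing L] [Nontrivial L] (j : Fin 4) {b : Fin 4 → L}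
    (hbj : b j = 0) (r : Fin 4 →₀ ℕ) (exc : Finset (Fin 4)) :
    IsEquimultiplePoint 2 Finset.univ j b (⟨X 0 * X 1 * X 2 * X 3, r, exc⟩ : CState (Fin 4) L) := by
  refine isEquimultiplePoint_of_two_mul_le_ordAlong j hbj ?_
  show ((2 * 2 : ℕ) : ℕ∞) ≤ ordAlong Finset.univ (X 0 * X 1 * X 2 * X 3 : MvPolynomial (Fin 4) L)
  have hF : (X 0 * X 1 * X 2 * X 3 : MvPolynomial (Fin 4) L) =
      monomial (Finsupp.single 0 1 + Finsupp.single 1 1 + Finsupp.single 2 1 + Finsupp.single 3 1) 1 := by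
    simp only [X, monomial_mul, mul_one]
  rw [hF, ordAlong_monomial _ _ one_ne_zero, degIn_univ]
  simp only [map_add, Finsupp.degree_single]
  norm_num

end Summit.ResolutionOfSingularities.ResolutionOfSingularities.Theorems.PIDim4.NearDim

end
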